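import Summits.HubbardSuperconductivity.ManyBodyBootstrap.Bounds.E2.HeisenbergRows
import Literature.MathematicalPhysics.QuantumLattice.HeisenbergOrderNeelShortRange
import HarnessLib

/-!
# Hubbard ladder — Bounds: the Néel variational ceiling `E₀(H_L) ≤ -L²/2` on every even torus
# `L ≥ 4`, and the E2 claim node `heisTL_upper_2x2_h0` closed by it

HONEST FRAMING (cell pub-hubbard): ladder R1–R4 with certified numbers; no claim on H/H₀. This is
a bound for a MODEL CLASS — the spin-½ Heisenberg antiferromagnet `H_L = Σ_{⟨xy⟩} 𝐒_x·𝐒_y`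
(`J = 1`) on the torus `(ℤ/Lℤ)²` — and it is PAPER-TRIVIAL: the Néel basis state has energy
`-|E|/4 = -L²/2`, so `E₀(H_L) ≤ -L²/2` by the variational principle (Anderson 1951;
Kennedy–Lieb–Shastry 1988, p. 1022). The tree already holds this, in Kennedy–Lieb–Shastry's
normalisation, as the Literature theorems `heisBondCorr_le` (`ε ≤ -S²/3`, the nearest-neighbour
ground-state correlation per component) and `heisBondCorr_eq_groundEnergy_div` (`ε = E₀/(3 d L^d)`);
this file only rewrites the pair as an energy statement and closes ONE E2 claim node with it:

* `heisTorus_groundEnergy_le_neel` — `E₀(H_{2k}) ≤ -(2k)²/2` for every `k ≥ 2`;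
* `heisTorusFamilyUpper_neel` — the torus-family form `HeisTorusFamilyUpper 2 4 (-1/2)`
  (every even `L ≥ 4`);
* `heisTorusFamilyUpper_of_le` — monotonicity of the family node in the constant;
* `heisTL_upper_2x2_h0_holds` — the E2 row `heisTL_upper_2x2_h0`
  (`HeisTorusFamilyUpper 2 4 (-549755813887/2⁴⁰)`, i.e. `e_L ≤ -0.49999999999909` for every even
  `L ≥ 4`; the open 2×2 cluster ground state with mean-field boundary has exactly the Néel value
  `-1/2` per site, and the row's constant is that value rounded up in binary).

What this does NOT close: the sibling row `heisTL_upper_2x2_cmf` (`q = -0.58405…`, also `L ≥ 4`)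
needs `E₀(H_4) ≤ -9.35` on the `4 × 4` torus, which no 2×2 product state reaches (their best is
`-8`) and for which the tree has no unconditional certificate yet; for even `L ≥ 6` the finite-depth
circuit ceiling of LEAN FILING REQUEST #219 (`heisTL_fdc_upper_2x2`, `q = -0.6585041`) is far
better than both. No materials claim. Companion text: `pub-hubbard/paper/bounds.tex` (§D44 update);
tables `pub-hubbard/pub-hubbard-bounds/BOUNDS.md`.
-/

namespace Summit.HubbardSuperconductivity.HubbardLadder.Bounds

open Literature.MathematicalPhysics.QuantumLattice Literature.Probability.LatticeModels
open Summit.HubbardSuperconductivity.ManyBodyBootstrap.Bounds.E2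

/-- **Néel variational ceiling** on the even torus `(ℤ/2kℤ)²`, `k ≥ 2`:
`E₀(Σ_{⟨xy⟩} 𝐒_x·𝐒_y) ≤ -(2k)²/2` (spin ½, `J = 1`; the Néel state has `-1/4` per bond on the
`2(2k)²` bonds). Kennedy–Lieb–Shastry (1988) p. 1022, via the tree's `heisBondCorr_le` and
`heisBondCorr_eq_groundEnergy_div`. -/
theorem heisTorus_groundEnergy_le_neel (k : ℕ) (hk : 2 ≤ k) [NeZero (2 * k)] :
    (heisenbergHamiltonian 1 (torusGraph 2 (2 * k)) 1).groundEnergy ≤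
      -(((2 * k : ℕ) : ℝ) ^ 2) / 2 := by
  have hε := heisBondCorr_le (d := 2) (by norm_num) 1 k hk
  have hE := heisBondCorr_eq_groundEnergy_div (d := 2) (by norm_num) 1 k hk
  have hL0 : (0 : ℝ) < ((2 * k : ℕ) : ℝ) := by
    have : 0 < 2 * k := by omega
    exact_mod_cast this
  have hden : (0 : ℝ) < 3 * ((2 : ℕ) : ℝ) * ((2 * k : ℕ) : ℝ) ^ (2 : ℕ) := by positivity
  rw [hE, div_le_iff₀ hden] at hε
  calc (heisenbergHamiltonian 1 (torusGraph 2 (2 * k)) 1).groundEnergy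
      ≤ -((((1 : ℕ) : ℝ) / 2) ^ 2 / 3) * (3 * ((2 : ℕ) : ℝ) * ((2 * k : ℕ) : ℝ) ^ (2 : ℕ)) := hε
    _ = -(((2 * k : ℕ) : ℝ) ^ 2) / 2 := by push_cast; ring

/-- **The Néel ceiling as a torus-family node**: `E₀(H_L) ≤ -L²/2` for every even `L ≥ 4`
(`HeisTorusFamilyUpper 2 4 (-1/2)`). Kennedy–Lieb–Shastry (1988) p. 1022. -/
theorem heisTorusFamilyUpper_neel : HeisTorusFamilyUpper 2 4 ((-1 : ℚ) / 2) := by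
  intro L _ h2 h4
  obtain ⟨k, hk⟩ := h2
  subst hk
  have hk2 : 2 ≤ k := by omega
  calc (heisenbergHamiltonian 1 (torusGraph 2 (2 * k)) 1).groundEnergy
      ≤ -(((2 * k : ℕ) : ℝ) ^ 2) / 2 := heisTorus_groundEnergy_le_neel k hk2
    _ = (((-1 : ℚ) / 2 : ℚ) : ℝ) * ((2 * k : ℕ) : ℝ) ^ 2 := by push_cast; ring

/-- Monotonicity of the torus-family node in the constant: a ceiling `q` is a ceiling `q' ≥ q`.
[folklore] -/
theorem heisTorusFamilyUpper_of_le {P L₀ : ℕ} {q q' : ℚ} (h : HeisTorusFamilyUpper P L₀ q)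
    (hq : q ≤ q') : HeisTorusFamilyUpper P L₀ q' := by
  intro L _ hP hL
  have hq' : (q : ℝ) ≤ (q' : ℝ) := by exact_mod_cast hq
  exact (h L hP hL).trans (mul_le_mul_of_nonneg_right hq' (by positivity))

/-- **E2 row `heisTL_upper_2x2_h0` closed**: `E₀(H_L) ≤ -0.49999999999909·L²` for every even
`L ≥ 4` — the Néel ceiling `-1/2` and `-1/2 ≤ -549755813887/2⁴⁰`. (The row records the open
2×2-cluster ground state with mean-field boundary, whose energy per site is exactly the Néel value
`-1/2`.) Kennedy–Lieb–Shastry (1988) p. 1022. -/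
theorem heisTL_upper_2x2_h0_holds : heisTL_upper_2x2_h0 :=
  heisTorusFamilyUpper_of_le heisTorusFamilyUpper_neel (by norm_num)

end Summit.HubbardSuperconductivity.HubbardLadder.Bounds
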